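import Literature.Computability.Complexity.BonamiLevelK
import HarnessLib

/-!
# Fourier growth of XOR-fibres of rectangle partitions

Topic `Literature/Computability/Complexity` (Boolean Fourier analysis / communication complexity).
The classical half of the algebraic oracle separation `BQP^A ⊄ BPP^Ã` (Aaronson–Wigderson's
Thm. 5.11(v), file `AlgebrizationBarriers.lean`) runs through the *communication* view of
algebraic queries (Aaronson–Wigderson, Thm. 4.11: a machine querying the multilinear extension of
`A = (A₀, A₁)` is simulated by a two-party protocol, Alice holding `A₀` and Bob `A₁`), i.e. through
functions on `{0,1}^m × {0,1}^m` that are constant on the parts of a partition into few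
*rectangles* `X_τ × Y_τ`, and through the *XOR-fibre* `h(W) = 𝔼_X acc(X, X ⊕ W)` of such a
function (Girish–Raz–Tal: the randomized communication lower bound for the XOR-lift of
Forrelation is proved by bounding the Fourier growth of exactly these fibres and feeding it to
Raz–Tal's theorem that functions of small Fourier growth cannot tell the Forrelation distribution
from uniform). This file proves that Fourier growth bound, in the all-levels form consumed by the
tree's Raz–Tal theorem (`abs_integral_truncEval_sub_le` of
`QuantumComplexity/RazTalBoundedDepth.lean`):

* `xorVec`, `xorFiber acc W = 2^{-m} ∑_X acc X (X ⊕ W)`; `IsRectangular tr` (every fibre of the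
  transcript function `tr` is a combinatorial rectangle: `tr x y = tr x' y' → tr x y' = tr x y`),
  `IsRectSimple K acc` (`acc = c ∘ tr` with `tr` rectangular into a type of cardinality `≤ K`,
  `|c| ≤ 1`), and the class `FiberAvg K g` of convex combinations of XOR-fibres of `K`-rectangle
  functions;
* `cubeFourierCoeff_xorFiber` (`ĥ(S) = 𝔼_{x,y} acc(x,y) χ_S(x) χ_S(y)`), hence for a rectangle
  function `ĥ(S) = ∑_τ c_τ · 1̂_{X_τ}(S) · 1̂_{Y_τ}(S)` (`cubeFourierCoeff_xorFiber_rect`);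
* **`IsRectSimple.l1Level_xorFiber_le`**: for `k ≥ 1`,
  `L_{1,k}(h) = ∑_{|S|=k} |ĥ(S)| ≤ (2e (ln K + 3))^k` — per rectangle
  `∑_{|S|=k} |1̂_X(S)| |1̂_Y(S)| ≤ √(W_k[1_X] W_k[1_Y]) ≤ e αβ (ln(1/(αβ)) + 3)^k` by the level-`k`
  inequality (`levelK_le_log`, file `BonamiLevelK.lean`) resp. `≤ √(αβ)` by Parseval, and the
  densities `w_τ = α_τ β_τ` of the rectangles of a partition sum to `1`;
* **`FiberAvg.l1Level_le`**, **`FiberAvg.abs_le_one`**, **`FiberAvg.piecewise`** (closure under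
  restrictions `W ↦ W|_{J ← σ}`: a restriction of a fibre is the average, over the values `ξ` of
  the mask on `J`, of the fibres of the sections `acc(ξ ∪ ·, (ξ ⊕ σ) ∪ ·)`, again `K`-rectangle
  functions), which together are the hypotheses of the Raz–Tal theorem with `L = 2e(ln K + 3)`.

Everything is proved; no named facts.

## References

* U. Girish, R. Raz, A. Tal, *Quantum versus randomized communication complexity, with efficient
  players*, ITCS 2021 (LIPIcs 185), Art. 54 / comput. complexity 31 (2022): §1.2 and §4 (Fourier
  growth of XOR-fibres of protocols via level-`k` inequalities; lower bound for lifted Forrelation).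
* S. Aaronson, A. Wigderson, *Algebrization: a new barrier in complexity theory*, STOC 2008 (full
  version), Thm. 4.11 (algebraic queries are simulated by communication) [AaronsonWigderson2008].
* R. O'Donnell, *Analysis of Boolean Functions*, CUP 2014, §9.5 (Level-`k` inequalities), §1.4
  (Parseval) [ODonnell2014].
* E. Kushilevitz, N. Nisan, *Communication Complexity*, CUP 1997, §1.2 (protocols partition the
  input matrix into combinatorial rectangles; Prop. 1.13–1.14).
-/

noncomputable section

namespace Literature.Computability.Complexity.LowDegree

open Finset Real Literature.Probability.RandomGraphs.LowDegree

variable {m : ℕ}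

/-! ### XOR translation on the cube -/

/-- Coordinatewise XOR of two points of the cube. [folklore] -/
def xorVec (x w : Fin m → Bool) : Fin m → Bool := fun i => xor (x i) (w i)

/-- Pointwise form. [folklore] -/
@[simp] theorem xorVec_apply (x w : Fin m → Bool) (i : Fin m) : xorVec x w i = xor (x i) (w i) := rfl

/-- `x ⊕ (x ⊕ w) = w`. [folklore] -/
@[simp] theorem xorVec_xorVec_cancel (x w : Fin m → Bool) : xorVec x (xorVec x w) = w := by
  funext i; simp

/-- Translation by `x` is an involution of the cube. [folklore] -/
theorem xorVec_involutive (x : Fin m → Bool) : Function.Involutive (xorVec x) :=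
  xorVec_xorVec_cancel x

/-- `χ(a ⊕ b) = χ(a) χ(b)`. [folklore] -/
theorem sgn_xor (a b : Bool) : sgn (xor a b) = sgn a * sgn b := by
  cases a <;> cases b <;> simp [sgn]

/-- **Characters are multiplicative under XOR**: `χ_S(x ⊕ w) = χ_S(x) χ_S(w)`. [cite: ODonnell2014, §1.2] -/
theorem walsh_xorVec (S : Finset (Fin m)) (x w : Fin m → Bool) :
    walsh S (xorVec x w) = walsh S x * walsh S w := by
  unfold walsh
  rw [← prod_mul_distrib]
  exact prod_congr rfl fun i _ => sgn_xor _ _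

/-- **Translation invariance of uniform sums**: `∑_w F(x ⊕ w) = ∑_w F(w)`. [folklore] -/
theorem sum_comp_xorVec (F : (Fin m → Bool) → ℝ) (x : Fin m → Bool) :
    ∑ w, F (xorVec x w) = ∑ w, F w :=
  Fintype.sum_equiv (xorVec_involutive x).toPerm _ _ fun _ => rfl

/-! ### XOR-fibres -/

/-- **The XOR-fibre** of a two-party function `acc : {0,1}^m × {0,1}^m → ℝ`:
`h(W) = 𝔼_X acc(X, X ⊕ W)` — the acceptance probability, over a uniformly random mask `X`, of a
protocol run on the masked pair `(X, X ⊕ W)` (Girish–Raz–Tal, §4). [cite: AaronsonWigderson2008, Thm. 4.11] -/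
def xorFiber (acc : (Fin m → Bool) → (Fin m → Bool) → ℝ) (w : Fin m → Bool) : ℝ :=
  (∑ x, acc x (xorVec x w)) / 2 ^ m

/-- A fibre of a `[-1,1]`-valued function is `[-1,1]`-valued. [folklore] -/
theorem abs_xorFiber_le_one {acc : (Fin m → Bool) → (Fin m → Bool) → ℝ}
    (h : ∀ x y, |acc x y| ≤ 1) (w : Fin m → Bool) : |xorFiber acc w| ≤ 1 := by
  unfold xorFiber
  rw [abs_div, abs_of_pos (by positivity : (0 : ℝ) < 2 ^ m), div_le_one (by positivity)]
  calc |∑ x, acc x (xorVec x w)| ≤ ∑ x, |acc x (xorVec x w)| := abs_sum_le_sum_abs _ _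
    _ ≤ ∑ _x : Fin m → Bool, (1 : ℝ) := sum_le_sum fun x _ => h x _
    _ = 2 ^ m := by simp

/-- **The coefficients of an XOR-fibre are the diagonal two-party coefficients**:
`ĥ(S) = 𝔼_{x,y}[acc(x,y) χ_S(x) χ_S(y)]` (substitute `y = x ⊕ w`, `χ_S(x ⊕ y) = χ_S(x)χ_S(y)`).
[cite: ODonnell2014, §1.2] -/
theorem cubeFourierCoeff_xorFiber (acc : (Fin m → Bool) → (Fin m → Bool) → ℝ) (S : Finset (Fin m)) :
    cubeFourierCoeff (xorFiber acc) S =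
      (∑ x, ∑ y, acc x y * (walsh S x * walsh S y)) / 2 ^ m / 2 ^ m := by
  unfold cubeFourierCoeff xorFiber
  congr 1
  calc ∑ w, (∑ x, acc x (xorVec x w)) / 2 ^ m * walsh S w
      = ∑ w, ∑ x, acc x (xorVec x w) * walsh S w / 2 ^ m := by
        refine sum_congr rfl fun w _ => ?_
        rw [div_mul_eq_mul_div, sum_mul, sum_div]
    _ = ∑ x, ∑ w, acc x (xorVec x w) * walsh S w / 2 ^ m := sum_comm
    _ = ∑ x, ∑ y, acc x y * (walsh S x * walsh S y) / 2 ^ m := by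
        refine sum_congr rfl fun x _ => ?_
        rw [← sum_comp_xorVec (fun w => acc x (xorVec x w) * walsh S w / 2 ^ m) x]
        refine sum_congr rfl fun y _ => ?_
        simp only [xorVec_xorVec_cancel, walsh_xorVec]
    _ = (∑ x, ∑ y, acc x y * (walsh S x * walsh S y)) / 2 ^ m := by
        rw [sum_div]
        exact sum_congr rfl fun x _ => by rw [sum_div]

/-- Coefficients of a finite linear combination. [cite: ODonnell2014, §1.2] -/
theorem cubeFourierCoeff_sum_mul {ι : Type*} (s : Finset ι) (μ : ι → ℝ)
    (h : ι → (Fin m → Bool) → ℝ) (S : Finset (Fin m)) :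
    cubeFourierCoeff (fun w => ∑ i ∈ s, μ i * h i w) S = ∑ i ∈ s, μ i * cubeFourierCoeff (h i) S := by
  unfold cubeFourierCoeff
  simp_rw [sum_mul, mul_div_assoc', ← sum_div]
  congr 1
  rw [sum_comm]
  refine sum_congr rfl fun i _ => ?_
  rw [mul_sum]
  exact sum_congr rfl fun w _ => by ring

/-! ### Rectangles -/

section RectGeneral

variable {X Y : Type*}

/-- A *transcript function* `tr` on `X × Y` is **rectangular** if each of its fibres is a
combinatorial rectangle `X_τ × Y_τ`: `tr x y = tr x' y'` forces `tr x y' = tr x y` (the cross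
property of rectangles; the transcript of a deterministic protocol is rectangular,
Kushilevitz–Nisan Prop. 1.14). [cite: AaronsonWigderson2008, Thm. 4.11] -/
def IsRectangular {T : Type*} (tr : X → Y → T) : Prop :=
  ∀ x x' y y', tr x y = tr x' y' → tr x y' = tr x y

/-- `acc` is a **`K`-rectangle function**: `acc = c ∘ tr` for a rectangular transcript function
`tr` into a type with at most `K` elements and values `|c| ≤ 1` (the acceptance indicator of a
deterministic protocol with at most `K` transcripts). [cite: AaronsonWigderson2008, Thm. 4.11] -/
def IsRectSimple (K : ℕ) (acc : X → Y → ℝ) : Prop :=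
  ∃ (T : Type) (_ : Fintype T) (tr : X → Y → T) (c : T → ℝ),
    Fintype.card T ≤ K ∧ IsRectangular tr ∧ (∀ τ, |c τ| ≤ 1) ∧ ∀ x y, acc x y = c (tr x y)

/-- A rectangle function is `[-1,1]`-valued. [folklore] -/
theorem IsRectSimple.abs_le_one {K : ℕ} {acc : X → Y → ℝ} (h : IsRectSimple K acc) (x : X) (y : Y) :
    |acc x y| ≤ 1 := by
  obtain ⟨T, _, tr, c, -, -, hc, hacc⟩ := h
  rw [hacc]; exact hc _

/-- **Sections / pull-backs of rectangle functions are rectangle functions** (same `K`): compose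
each player's input with an arbitrary map. [folklore] -/
theorem IsRectSimple.comap {K : ℕ} {acc : X → Y → ℝ} (h : IsRectSimple K acc) {X' Y' : Type*}
    (φ : X' → X) (ψ : Y' → Y) : IsRectSimple K fun x y => acc (φ x) (ψ y) := by
  obtain ⟨T, hT, tr, c, hcard, hrect, hc1, hacc⟩ := h
  exact ⟨T, hT, fun x y => tr (φ x) (ψ y), c, hcard, fun x x' y y' hxy => hrect _ _ _ _ hxy, hc1,
    fun x y => hacc _ _⟩

variable {T : Type} (tr : X → Y → T)

/-- The row set `X_τ = {x | ∃ y, tr x y = τ}` of the fibre of `τ`, as a `{0,1}`-valued function. [folklore] -/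
def rowInd (τ : T) (x : X) : ℝ := by
  classical exact if ∃ y, tr x y = τ then 1 else 0

/-- The column set `Y_τ = {y | ∃ x, tr x y = τ}` of the fibre of `τ`, as a `{0,1}`-valued function. [folklore] -/
def colInd (τ : T) (y : Y) : ℝ := by
  classical exact if ∃ x, tr x y = τ then 1 else 0

/-- Row indicators are `{0,1}`-valued. [folklore] -/
theorem rowInd_eq_zero_or_one (τ : T) (x : X) : rowInd tr τ x = 0 ∨ rowInd tr τ x = 1 := by
  unfold rowInd; split_ifs <;> simp

/-- Column indicators are `{0,1}`-valued. [folklore] -/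
theorem colInd_eq_zero_or_one (τ : T) (y : Y) : colInd tr τ y = 0 ∨ colInd tr τ y = 1 := by
  unfold colInd; split_ifs <;> simp

variable {tr} [DecidableEq T]

/-- **Fibres of a rectangular function are rectangles**: `[tr x y = τ] = 1_{X_τ}(x) 1_{Y_τ}(y)`.
[cite: AaronsonWigderson2008, Thm. 4.11] -/
theorem ite_eq_rowInd_mul_colInd (h : IsRectangular tr) (τ : T) (x : X) (y : Y) :
    (if tr x y = τ then (1 : ℝ) else 0) = rowInd tr τ x * colInd tr τ y := by
  classical
  unfold rowInd colInd
  by_cases hxy : tr x y = τ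
  · rw [if_pos hxy, if_pos ⟨y, hxy⟩, if_pos ⟨x, hxy⟩, one_mul]
  · rw [if_neg hxy]
    by_cases hx : ∃ y', tr x y' = τ
    · by_cases hy : ∃ x', tr x' y = τ
      · exfalso
        obtain ⟨y', hy'⟩ := hx
        obtain ⟨x', hx'⟩ := hy
        exact hxy ((h x x' y' y (hy'.trans hx'.symm)).trans hy')
      · rw [if_neg hy, mul_zero]
    · rw [if_neg hx, zero_mul]

end RectGeneral

section Rect

variable {T : Type} [DecidableEq T] {tr : (Fin m → Bool) → (Fin m → Bool) → T} [Fintype T]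

/-- **The coefficients of the XOR-fibre of a rectangle function**:
`ĥ(S) = ∑_τ c_τ 1̂_{X_τ}(S) 1̂_{Y_τ}(S)`. [cite: AaronsonWigderson2008, Thm. 4.11] -/
theorem cubeFourierCoeff_xorFiber_rect (h : IsRectangular tr) (c : T → ℝ) (S : Finset (Fin m)) :
    cubeFourierCoeff (xorFiber fun x y => c (tr x y)) S =
      ∑ τ, c τ * (cubeFourierCoeff (rowInd tr τ) S * cubeFourierCoeff (colInd tr τ) S) := by
  classical
  rw [cubeFourierCoeff_xorFiber]
  have e : ∀ x y, c (tr x y) = ∑ τ, c τ * (rowInd tr τ x * colInd tr τ y) := by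
    intro x y
    have : ∑ τ, c τ * (rowInd tr τ x * colInd tr τ y) = ∑ τ, (if tr x y = τ then c τ else 0) := by
      refine sum_congr rfl fun τ _ => ?_
      rw [← ite_eq_rowInd_mul_colInd h, mul_ite, mul_one, mul_zero]
    rw [this, sum_ite_eq]
    simp
  have lhs : ∑ x, ∑ y, c (tr x y) * (walsh S x * walsh S y) =
      ∑ τ, c τ * ((∑ x, rowInd tr τ x * walsh S x) * (∑ y, colInd tr τ y * walsh S y)) := by
    calc ∑ x, ∑ y, c (tr x y) * (walsh S x * walsh S y)
        = ∑ x, ∑ y, ∑ τ, c τ * (rowInd tr τ x * walsh S x) * (colInd tr τ y * walsh S y) := by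
          refine sum_congr rfl fun x _ => sum_congr rfl fun y _ => ?_
          rw [e x y, sum_mul]
          exact sum_congr rfl fun τ _ => by ring
      _ = ∑ x, ∑ τ, ∑ y, c τ * (rowInd tr τ x * walsh S x) * (colInd tr τ y * walsh S y) :=
          sum_congr rfl fun x _ => sum_comm
      _ = ∑ τ, ∑ x, ∑ y, c τ * (rowInd tr τ x * walsh S x) * (colInd tr τ y * walsh S y) := sum_comm
      _ = ∑ τ, c τ * ((∑ x, rowInd tr τ x * walsh S x) * (∑ y, colInd tr τ y * walsh S y)) := by
          refine sum_congr rfl fun τ _ => ?_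
          rw [Finset.sum_mul_sum, mul_sum]
          refine sum_congr rfl fun x _ => ?_
          rw [mul_sum]
          exact sum_congr rfl fun y _ => by ring
  rw [lhs, sum_div, sum_div]
  refine sum_congr rfl fun τ _ => ?_
  unfold cubeFourierCoeff
  ring

/-- **The densities of the rectangles of a partition sum to one**:
`∑_τ α_τ β_τ = 1`, `α_τ = |X_τ|/2^m`, `β_τ = |Y_τ|/2^m`. [cite: AaronsonWigderson2008, Thm. 4.11] -/
theorem sum_rowMean_mul_colMean (h : IsRectangular tr) :
    ∑ τ, cubeFourierCoeff (rowInd tr τ) ∅ * cubeFourierCoeff (colInd tr τ) ∅ = 1 := by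
  classical
  simp only [cubeFourierCoeff_empty]
  have key : ∀ τ, (∑ x, rowInd tr τ x) * (∑ y, colInd tr τ y) =
      ∑ x : Fin m → Bool, ∑ y : Fin m → Bool, (if tr x y = τ then (1 : ℝ) else 0) := by
    intro τ
    rw [Finset.sum_mul_sum]
    exact sum_congr rfl fun x _ => sum_congr rfl fun y _ => (ite_eq_rowInd_mul_colInd h τ x y).symm
  have hN : (0 : ℝ) < 2 ^ m := by positivity
  calc ∑ τ, (∑ x, rowInd tr τ x) / 2 ^ m * ((∑ y, colInd tr τ y) / 2 ^ m)
      = (∑ τ, (∑ x, rowInd tr τ x) * (∑ y, colInd tr τ y)) / (2 ^ m * 2 ^ m) := by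
        rw [sum_div]
        exact sum_congr rfl fun τ _ => by ring
    _ = (∑ τ, ∑ x : Fin m → Bool, ∑ y : Fin m → Bool, (if tr x y = τ then (1 : ℝ) else 0)) /
          (2 ^ m * 2 ^ m) := by simp_rw [key]
    _ = (∑ _x : Fin m → Bool, ∑ _y : Fin m → Bool, (1 : ℝ)) / (2 ^ m * 2 ^ m) := by
        congr 1
        rw [sum_comm]
        refine sum_congr rfl fun x _ => ?_
        rw [sum_comm]
        refine sum_congr rfl fun y _ => ?_
        rw [sum_ite_eq]
        simp
    _ = 1 := by
        rw [sum_const, card_univ, sum_const, card_univ, Fintype.card_fun, Fintype.card_bool,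
          Fintype.card_fin, nsmul_eq_mul, nsmul_eq_mul, mul_one]
        push_cast
        exact div_self (by positivity)

end Rect

/-! ### The per-rectangle bounds -/

/-- A `{0,1}`-valued function has mean zero only if it vanishes. [folklore] -/
theorem eq_zero_of_mean_eq_zero {a : (Fin m → Bool) → ℝ} (ha : ∀ x, a x = 0 ∨ a x = 1)
    (h0 : cubeFourierCoeff a ∅ = 0) (x : Fin m → Bool) : a x = 0 := by
  rw [cubeFourierCoeff_empty, div_eq_zero_iff] at h0
  have hs : ∑ x, a x = 0 := h0.resolve_right (by positivity)
  have hnn : ∀ y, 0 ≤ a y := fun y => by rcases ha y with h | h <;> simp [h]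
  exact (sum_eq_zero_iff_of_nonneg fun y _ => hnn y).1 hs x (mem_univ x)

/-- The mean of a `{0,1}`-valued function lies in `[0,1]`. [folklore] -/
theorem mean_mem_unitInterval {a : (Fin m → Bool) → ℝ} (ha : ∀ x, a x = 0 ∨ a x = 1) :
    0 ≤ cubeFourierCoeff a ∅ ∧ cubeFourierCoeff a ∅ ≤ 1 := by
  rw [cubeFourierCoeff_empty]
  have hnn : ∀ y, 0 ≤ a y := fun y => by rcases ha y with h | h <;> simp [h]
  have hle : ∀ y, a y ≤ 1 := fun y => by rcases ha y with h | h <;> simp [h]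
  refine ⟨div_nonneg (sum_nonneg fun y _ => hnn y) (by positivity), ?_⟩
  rw [div_le_one (by positivity)]
  calc ∑ y, a y ≤ ∑ _y : Fin m → Bool, (1 : ℝ) := sum_le_sum fun y _ => hle y
    _ = 2 ^ m := by simp

/-- **Parseval bound for one rectangle**: `∑_{|S|=k} |1̂_X(S)| |1̂_Y(S)| ≤ √(αβ)`
(Cauchy–Schwarz, `W_k ≤ 𝔼[1_X²] = α`). [cite: ODonnell2014, §1.4] -/
theorem sum_abs_mul_abs_le_sqrt {a b : (Fin m → Bool) → ℝ} (ha : ∀ x, a x = 0 ∨ a x = 1)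
    (hb : ∀ x, b x = 0 ∨ b x = 1) (k : ℕ) :
    ∑ S ∈ univ.powersetCard k, |cubeFourierCoeff a S| * |cubeFourierCoeff b S| ≤
      Real.sqrt (cubeFourierCoeff a ∅ * cubeFourierCoeff b ∅) := by
  have hsqa : ∀ x, a x ^ 2 = a x := fun x => by rcases ha x with h | h <;> simp [h]
  have hsqb : ∀ x, b x ^ 2 = b x := fun x => by rcases hb x with h | h <;> simp [h]
  have hPa : ∑ S ∈ univ.powersetCard k, |cubeFourierCoeff a S| ^ 2 ≤ cubeFourierCoeff a ∅ := by
    calc ∑ S ∈ univ.powersetCard k, |cubeFourierCoeff a S| ^ 2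
        ≤ ∑ S, |cubeFourierCoeff a S| ^ 2 :=
          sum_le_sum_of_subset_of_nonneg (subset_univ _) fun S _ _ => sq_nonneg _
      _ = (∑ x, a x ^ 2) / 2 ^ m := by simp_rw [sq_abs]; exact sum_cubeFourierCoeff_sq a
      _ = cubeFourierCoeff a ∅ := by rw [cubeFourierCoeff_empty]; simp_rw [hsqa]
  have hPb : ∑ S ∈ univ.powersetCard k, |cubeFourierCoeff b S| ^ 2 ≤ cubeFourierCoeff b ∅ := by
    calc ∑ S ∈ univ.powersetCard k, |cubeFourierCoeff b S| ^ 2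
        ≤ ∑ S, |cubeFourierCoeff b S| ^ 2 :=
          sum_le_sum_of_subset_of_nonneg (subset_univ _) fun S _ _ => sq_nonneg _
      _ = (∑ x, b x ^ 2) / 2 ^ m := by simp_rw [sq_abs]; exact sum_cubeFourierCoeff_sq b
      _ = cubeFourierCoeff b ∅ := by rw [cubeFourierCoeff_empty]; simp_rw [hsqb]
  refine Real.le_sqrt_of_sq_le ?_
  calc (∑ S ∈ univ.powersetCard k, |cubeFourierCoeff a S| * |cubeFourierCoeff b S|) ^ 2
      ≤ (∑ S ∈ univ.powersetCard k, |cubeFourierCoeff a S| ^ 2) *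
          (∑ S ∈ univ.powersetCard k, |cubeFourierCoeff b S| ^ 2) := sum_mul_sq_le_sq_mul_sq _ _ _
    _ ≤ cubeFourierCoeff a ∅ * cubeFourierCoeff b ∅ :=
        mul_le_mul hPa hPb (sum_nonneg fun _ _ => sq_nonneg _) (mean_mem_unitInterval ha).1

/-- **Hypercontractive bound for one rectangle**:
`∑_{|S|=k} |1̂_X(S)| |1̂_Y(S)| ≤ e · αβ · (ln(1/(αβ)) + 3)^k`
(Cauchy–Schwarz, the level-`k` inequality for both factors, and
`(2 ln(1/α) + 3)(2 ln(1/β) + 3) ≤ (ln(1/(αβ)) + 3)²`). [cite: ODonnell2014, §9.5 (Level-k Inequalities)] -/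
theorem sum_abs_mul_abs_le_log {a b : (Fin m → Bool) → ℝ} (ha : ∀ x, a x = 0 ∨ a x = 1)
    (hb : ∀ x, b x = 0 ∨ b x = 1) (k : ℕ) :
    ∑ S ∈ univ.powersetCard k, |cubeFourierCoeff a S| * |cubeFourierCoeff b S| ≤
      Real.exp 1 * (cubeFourierCoeff a ∅ * cubeFourierCoeff b ∅) *
        (Real.log (1 / (cubeFourierCoeff a ∅ * cubeFourierCoeff b ∅)) + 3) ^ k := by
  set α := cubeFourierCoeff a ∅ with hα
  set β := cubeFourierCoeff b ∅ with hβ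
  have hα01 := mean_mem_unitInterval ha
  have hβ01 := mean_mem_unitInterval hb
  rw [← hα] at hα01
  rw [← hβ] at hβ01
  -- degenerate rectangles
  rcases hα01.1.eq_or_lt with hα0 | hαpos
  · have hz : ∀ S, cubeFourierCoeff a S = 0 := by
      intro S
      have h0 : ∀ x, a x = 0 := eq_zero_of_mean_eq_zero ha (by rw [← hα, ← hα0])
      unfold cubeFourierCoeff
      rw [div_eq_zero_iff]; exact Or.inl (sum_eq_zero fun x _ => by rw [h0 x, zero_mul])
    rw [← hα0]
    simp [hz]
  rcases hβ01.1.eq_or_lt with hβ0 | hβpos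
  · have hz : ∀ S, cubeFourierCoeff b S = 0 := by
      intro S
      have h0 : ∀ x, b x = 0 := eq_zero_of_mean_eq_zero hb (by rw [← hβ, ← hβ0])
      unfold cubeFourierCoeff
      rw [div_eq_zero_iff]; exact Or.inl (sum_eq_zero fun x _ => by rw [h0 x, zero_mul])
    rw [← hβ0]
    simp [hz]
  -- the level-`k` inequality for both factors
  have hnn_a : ∀ x, 0 ≤ a x := fun x => by rcases ha x with h | h <;> simp [h]
  have hle_a : ∀ x, a x ≤ 1 := fun x => by rcases ha x with h | h <;> simp [h]
  have hnn_b : ∀ x, 0 ≤ b x := fun x => by rcases hb x with h | h <;> simp [h]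
  have hle_b : ∀ x, b x ≤ 1 := fun x => by rcases hb x with h | h <;> simp [h]
  have hWa := levelK_le_log a hnn_a hle_a k (by rwa [← hα])
  have hWb := levelK_le_log b hnn_b hle_b k (by rwa [← hβ])
  rw [← hα] at hWa
  rw [← hβ] at hWb
  set A := 2 * Real.log (1 / α) + 3 with hA
  set B := 2 * Real.log (1 / β) + 3 with hB
  set C := Real.log (1 / (α * β)) + 3 with hC
  have hlogα : 0 ≤ Real.log (1 / α) := Real.log_nonneg (by rw [le_div_iff₀ hαpos]; linarith [hα01.2])
  have hlogβ : 0 ≤ Real.log (1 / β) := Real.log_nonneg (by rw [le_div_iff₀ hβpos]; linarith [hβ01.2])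
  have hA0 : 0 ≤ A := by rw [hA]; linarith
  have hB0 : 0 ≤ B := by rw [hB]; linarith
  have hABC : A + B = 2 * C := by
    have hl : Real.log (1 / (α * β)) = Real.log (1 / α) + Real.log (1 / β) := by
      rw [one_div, mul_inv, Real.log_mul (by positivity) (by positivity), one_div, one_div]
    rw [hA, hB, hC, hl]
    ring
  have hC0 : 0 ≤ C := by linarith
  have hAB : A * B ≤ C ^ 2 := by nlinarith [sq_nonneg (A - B)]
  -- Cauchy–Schwarz and assembly
  set P := ∑ S ∈ univ.powersetCard k, |cubeFourierCoeff a S| * |cubeFourierCoeff b S| with hP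
  have hP0 : 0 ≤ P := sum_nonneg fun S _ => mul_nonneg (abs_nonneg _) (abs_nonneg _)
  have hCS : P ^ 2 ≤ levelWeight a k * levelWeight b k := by
    have h := sum_mul_sq_le_sq_mul_sq (univ.powersetCard k)
      (fun S => |cubeFourierCoeff a S|) (fun S => |cubeFourierCoeff b S|)
    simp only [sq_abs] at h
    exact h
  have hsq : P ^ 2 ≤ (Real.exp 1 * (α * β) * C ^ k) ^ 2 := by
    calc P ^ 2 ≤ levelWeight a k * levelWeight b k := hCS
      _ ≤ (Real.exp 1 * α ^ 2 * A ^ k) * (Real.exp 1 * β ^ 2 * B ^ k) :=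
          mul_le_mul hWa hWb (levelWeight_nonneg b k) (by positivity)
      _ = (Real.exp 1 * (α * β)) ^ 2 * (A * B) ^ k := by ring
      _ ≤ (Real.exp 1 * (α * β)) ^ 2 * (C ^ 2) ^ k :=
          mul_le_mul_of_nonneg_left (pow_le_pow_left₀ (by positivity) hAB k) (by positivity)
      _ = (Real.exp 1 * (α * β) * C ^ k) ^ 2 := by ring
  exact (pow_le_pow_iff_left₀ hP0
    (mul_nonneg (mul_nonneg (Real.exp_pos 1).le (mul_pos hαpos hβpos).le) (pow_nonneg hC0 k))
    two_ne_zero).1 hsq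

/-! ### Summing over the rectangles -/

/-- **Monotonicity of `w ↦ w (ln(1/w) + 3)^k` below `e^{3-k}`**: for `0 < w ≤ δ ≤ 1` and
`k ≤ ln(1/δ) + 3`, `w (ln(1/w)+3)^k ≤ δ (ln(1/δ)+3)^k` (from `ln t ≤ t - 1`: with
`u = ln(1/w)+3 ≥ v = ln(1/δ)+3 ≥ k`, `(u/v)^k ≤ e^{u-v} = δ/w`). [folklore] -/
theorem mul_log_pow_le {w δ : ℝ} {k : ℕ} (hw : 0 < w) (hwδ : w ≤ δ) (hδ : δ ≤ 1)
    (hk : (k : ℝ) ≤ Real.log (1 / δ) + 3) :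
    w * (Real.log (1 / w) + 3) ^ k ≤ δ * (Real.log (1 / δ) + 3) ^ k := by
  have hδ0 : 0 < δ := lt_of_lt_of_le hw hwδ
  set u := Real.log (1 / w) + 3 with hu
  set v := Real.log (1 / δ) + 3 with hv
  have hlogδ : 0 ≤ Real.log (1 / δ) := Real.log_nonneg (by rw [le_div_iff₀ hδ0]; linarith)
  have hv3 : 3 ≤ v := by rw [hv]; linarith
  have hvpos : 0 < v := by linarith
  have huv : v ≤ u := by
    rw [hu, hv]
    have := Real.log_le_log (by positivity) (one_div_le_one_div_of_le hw hwδ)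
    linarith
  have hupos : 0 < u := by linarith
  -- `(u/v)^k ≤ exp (u - v)`
  have h1 : (u / v) ^ k ≤ Real.exp (u - v) := by
    have hlog : Real.log (u / v) ≤ (u - v) / v := by
      have := Real.log_le_sub_one_of_pos (div_pos hupos hvpos)
      rwa [div_sub_one hvpos.ne'] at this
    have hk' : (k : ℝ) * Real.log (u / v) ≤ u - v := by
      calc (k : ℝ) * Real.log (u / v) ≤ v * ((u - v) / v) := by
            refine mul_le_mul hk hlog (Real.log_nonneg ?_) hvpos.le
            rw [le_div_iff₀ hvpos]; linarith
        _ = u - v := by field_simp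
    calc (u / v) ^ k = Real.exp (Real.log (u / v)) ^ k := by rw [Real.exp_log (div_pos hupos hvpos)]
      _ = Real.exp (k * Real.log (u / v)) := (Real.exp_nat_mul _ _).symm
      _ ≤ Real.exp (u - v) := Real.exp_le_exp.2 hk'
  -- `exp (u - v) = δ / w`
  have h2 : Real.exp (u - v) = δ / w := by
    rw [hu, hv, show Real.log (1 / w) + 3 - (Real.log (1 / δ) + 3) = Real.log (1 / w) - Real.log (1 / δ) by ring,
      Real.exp_sub, Real.exp_log (by positivity), Real.exp_log (by positivity)]
    field_simp
  have h3 : u ^ k ≤ δ / w * v ^ k := by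
    have := mul_le_mul_of_nonneg_right (h1.trans_eq h2) (pow_nonneg hvpos.le k)
    rwa [div_pow, div_mul_cancel₀ _ (pow_ne_zero k hvpos.ne')] at this
  calc w * u ^ k ≤ w * (δ / w * v ^ k) := mul_le_mul_of_nonneg_left h3 hw.le
    _ = δ * v ^ k := by field_simp

/-- The growth parameter `L(K) = 2e (ln K + 3)`. [folklore] -/
def growthConst (K : ℕ) : ℝ := 2 * Real.exp 1 * (Real.log K + 3)

/-- `L(K) ≥ 6e > 0`. [folklore] -/
theorem growthConst_pos {K : ℕ} (hK : 1 ≤ K) : 0 < growthConst K := by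
  unfold growthConst
  have : 0 ≤ Real.log K := Real.log_nonneg (by exact_mod_cast hK)
  positivity

/-- **Fourier growth of the XOR-fibre of a rectangle function** (Girish–Raz–Tal, §4, for
protocols; here for any function constant on the parts of a partition into `≤ K` rectangles): for
every `k ≥ 1`, `L_{1,k}(h) = ∑_{|S|=k} |ĥ(S)| ≤ (2e (ln K + 3))^k`. Proof:
`L_{1,k}(h) ≤ ∑_τ ∑_{|S|=k} |1̂_{X_τ}(S)| |1̂_{Y_τ}(S)|`; if `k ≤ ln K + 3` each rectangle contributes
`≤ e (w_τ + 1/K)(ln K + 3)^k` (the level-`k` bound, monotone in the density `w_τ = α_τ β_τ` below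
`1/K`, and `ln(1/w_τ) ≤ ln K` above), and `∑_τ w_τ = 1`, at most `K` parts; if `k > ln K + 3` the
Parseval bound gives `≤ ∑_τ √w_τ ≤ √K ≤ e^k`. [cite: ODonnell2014, §9.5 (Level-k Inequalities)] -/
theorem IsRectSimple.l1Level_xorFiber_le {K : ℕ} {acc : (Fin m → Bool) → (Fin m → Bool) → ℝ}
    (hacc : IsRectSimple K acc) {k : ℕ} (hk : 1 ≤ k) :
    l1Level (xorFiber acc) k ≤ growthConst K ^ k := by
  classical
  obtain ⟨T, hT, tr, c, hcard, hrect, hc1, hacc⟩ := hacc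
  -- `K ≥ 1`
  have x0 : Fin m → Bool := fun _ => false
  have hTpos : 0 < Fintype.card T := Fintype.card_pos_iff.2 ⟨tr x0 x0⟩
  have hK : 1 ≤ K := le_trans hTpos hcard
  have hKr : (1 : ℝ) ≤ K := by exact_mod_cast hK
  have hKpos : (0 : ℝ) < K := by linarith
  have hlogK : 0 ≤ Real.log K := Real.log_nonneg hKr
  set ℓ : ℝ := Real.log K + 3 with hℓ
  have hℓ3 : 3 ≤ ℓ := by rw [hℓ]; linarith
  -- notation
  set α : T → ℝ := fun τ => cubeFourierCoeff (rowInd tr τ) ∅ with hα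
  set β : T → ℝ := fun τ => cubeFourierCoeff (colInd tr τ) ∅ with hβ
  set w : T → ℝ := fun τ => α τ * β τ with hw
  set P : T → ℝ := fun τ => ∑ S ∈ univ.powersetCard k,
    |cubeFourierCoeff (rowInd tr τ) S| * |cubeFourierCoeff (colInd tr τ) S| with hP
  have hrow01 := rowInd_eq_zero_or_one tr
  have hcol01 := colInd_eq_zero_or_one tr
  have hw0 : ∀ τ, 0 ≤ w τ := fun τ =>
    mul_nonneg (mean_mem_unitInterval (hrow01 τ)).1 (mean_mem_unitInterval (hcol01 τ)).1
  have hw1 : ∀ τ, w τ ≤ 1 := fun τ =>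
    mul_le_one₀ (mean_mem_unitInterval (hrow01 τ)).2 (mean_mem_unitInterval (hcol01 τ)).1
      (mean_mem_unitInterval (hcol01 τ)).2
  have hsumw : ∑ τ, w τ = 1 := sum_rowMean_mul_colMean hrect
  have hP0 : ∀ τ, 0 ≤ P τ := fun τ => sum_nonneg fun S _ => mul_nonneg (abs_nonneg _) (abs_nonneg _)
  -- Step 1: `L_{1,k}(h) ≤ ∑_τ P τ`
  have hacc' : acc = fun x y => c (tr x y) := funext fun x => funext fun y => hacc x y
  have step1 : l1Level (xorFiber acc) k ≤ ∑ τ, P τ := by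
    unfold l1Level
    rw [hacc']
    calc ∑ S ∈ univ.powersetCard k, |cubeFourierCoeff (xorFiber fun x y => c (tr x y)) S|
        ≤ ∑ S ∈ univ.powersetCard k, ∑ τ,
            |cubeFourierCoeff (rowInd tr τ) S| * |cubeFourierCoeff (colInd tr τ) S| := by
          refine sum_le_sum fun S _ => ?_
          rw [cubeFourierCoeff_xorFiber_rect hrect]
          refine (abs_sum_le_sum_abs _ _).trans (sum_le_sum fun τ _ => ?_)
          rw [abs_mul, abs_mul]
          calc |c τ| * (|cubeFourierCoeff (rowInd tr τ) S| * |cubeFourierCoeff (colInd tr τ) S|)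
              ≤ 1 * (|cubeFourierCoeff (rowInd tr τ) S| * |cubeFourierCoeff (colInd tr τ) S|) :=
                mul_le_mul_of_nonneg_right (hc1 τ) (by positivity)
            _ = _ := one_mul _
      _ = ∑ τ, P τ := sum_comm
  refine step1.trans ?_
  -- Step 2: the two per-rectangle bounds
  have bd_log : ∀ τ, P τ ≤ Real.exp 1 * w τ * (Real.log (1 / w τ) + 3) ^ k := fun τ =>
    sum_abs_mul_abs_le_log (hrow01 τ) (hcol01 τ) k
  have bd_sqrt : ∀ τ, P τ ≤ Real.sqrt (w τ) := fun τ =>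
    sum_abs_mul_abs_le_sqrt (hrow01 τ) (hcol01 τ) k
  have hcardK : (Fintype.card T : ℝ) ≤ K := by exact_mod_cast hcard
  -- Step 3: case analysis on `k` versus `ln K + 3`
  by_cases hkℓ : (k : ℝ) ≤ ℓ
  · -- small levels: hypercontractive bound
    have hpt : ∀ τ, P τ ≤ Real.exp 1 * (w τ + 1 / K) * ℓ ^ k := by
      intro τ
      refine (bd_log τ).trans ?_
      rcases (hw0 τ).eq_or_lt with hwz | hwpos
      · rw [← hwz]; simp only [mul_zero, zero_mul, zero_add]; positivity
      by_cases hwK : 1 / (K : ℝ) ≤ w τ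
      · -- `ln(1/w) ≤ ln K`
        have hlog : Real.log (1 / w τ) ≤ Real.log K := by
          refine Real.log_le_log (by positivity) ?_
          rw [div_le_iff₀ hwpos]
          rw [div_le_iff₀ hKpos] at hwK
          linarith
        have hl0 : 0 ≤ Real.log (1 / w τ) + 3 := by
          have : 0 ≤ Real.log (1 / w τ) := Real.log_nonneg (by rw [le_div_iff₀ hwpos]; linarith [hw1 τ])
          linarith
        calc Real.exp 1 * w τ * (Real.log (1 / w τ) + 3) ^ k ≤ Real.exp 1 * w τ * ℓ ^ k :=
              mul_le_mul_of_nonneg_left (pow_le_pow_left₀ hl0 (by rw [hℓ]; linarith) k) (by positivity)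
          _ ≤ Real.exp 1 * (w τ + 1 / K) * ℓ ^ k := by
              refine mul_le_mul_of_nonneg_right (mul_le_mul_of_nonneg_left ?_ (Real.exp_pos 1).le)
                (by positivity)
              simp only [le_add_iff_nonneg_right]
              positivity
      · push Not at hwK
        have hmono := mul_log_pow_le (δ := 1 / K) hwpos hwK.le
          (by rw [div_le_one hKpos]; exact hKr) (by rw [one_div_one_div]; exact hkℓ)
        rw [one_div_one_div] at hmono
        calc Real.exp 1 * w τ * (Real.log (1 / w τ) + 3) ^ k
            = Real.exp 1 * (w τ * (Real.log (1 / w τ) + 3) ^ k) := by ring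
          _ ≤ Real.exp 1 * (1 / K * ℓ ^ k) := mul_le_mul_of_nonneg_left hmono (Real.exp_pos 1).le
          _ ≤ Real.exp 1 * ((w τ + 1 / K) * ℓ ^ k) := by
              refine mul_le_mul_of_nonneg_left (mul_le_mul_of_nonneg_right (by linarith) ?_)
                (Real.exp_pos 1).le
              positivity
          _ = Real.exp 1 * (w τ + 1 / K) * ℓ ^ k := by ring
    calc ∑ τ, P τ ≤ ∑ τ, Real.exp 1 * (w τ + 1 / K) * ℓ ^ k := sum_le_sum fun τ _ => hpt τ
      _ = Real.exp 1 * (∑ τ, w τ + Fintype.card T * (1 / K)) * ℓ ^ k := by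
          rw [← sum_mul, ← mul_sum, sum_add_distrib, sum_const, card_univ, nsmul_eq_mul]
      _ ≤ Real.exp 1 * (1 + 1) * ℓ ^ k := by
          rw [hsumw]
          refine mul_le_mul_of_nonneg_right (mul_le_mul_of_nonneg_left ?_ (Real.exp_pos 1).le)
            (by positivity)
          have : (Fintype.card T : ℝ) * (1 / K) ≤ 1 := by
            rw [mul_one_div, div_le_one hKpos]; exact hcardK
          linarith
      _ = (2 * Real.exp 1) * ℓ ^ k := by ring
      _ ≤ (2 * Real.exp 1) ^ k * ℓ ^ k := by
          refine mul_le_mul_of_nonneg_right (le_self_pow₀ ?_ (by omega)) (by positivity)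
          linarith [Real.add_one_le_exp (1 : ℝ)]
      _ = growthConst K ^ k := by rw [growthConst, ← hℓ]; ring
  · -- large levels: Parseval bound
    push Not at hkℓ
    have hCS : (∑ τ, Real.sqrt (w τ)) ^ 2 ≤ Fintype.card T := by
      have h := sum_mul_sq_le_sq_mul_sq (univ : Finset T) (fun τ => Real.sqrt (w τ)) (fun _ => (1 : ℝ))
      simp only [mul_one, one_pow, sum_const, card_univ, nsmul_eq_mul] at h
      calc (∑ τ, Real.sqrt (w τ)) ^ 2 ≤ (∑ τ, Real.sqrt (w τ) ^ 2) * Fintype.card T := h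
        _ = (∑ τ, w τ) * Fintype.card T := by
            congr 1
            exact sum_congr rfl fun τ _ => Real.sq_sqrt (hw0 τ)
        _ = Fintype.card T := by rw [hsumw, one_mul]
    have hsum_sqrt : ∑ τ, Real.sqrt (w τ) ≤ K := by
      have h1 : ∑ τ, Real.sqrt (w τ) ≤ Real.sqrt K :=
        Real.le_sqrt_of_sq_le (hCS.trans hcardK)
      refine h1.trans ?_
      rw [Real.sqrt_le_left (by positivity)]
      nlinarith
    calc ∑ τ, P τ ≤ ∑ τ, Real.sqrt (w τ) := sum_le_sum fun τ _ => bd_sqrt τ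
      _ ≤ K := hsum_sqrt
      _ = Real.exp (Real.log K) := (Real.exp_log hKpos).symm
      _ ≤ Real.exp k := Real.exp_le_exp.2 (by rw [hℓ] at hkℓ; linarith)
      _ = Real.exp 1 ^ k := by rw [← Real.exp_nat_mul, mul_one]
      _ ≤ growthConst K ^ k := by
          refine pow_le_pow_left₀ (Real.exp_pos 1).le ?_ k
          rw [growthConst]
          nlinarith [Real.exp_pos 1, hlogK]

/-! ### Convex combinations of fibres, and restrictions -/

/-- **The class fooled by the Forrelation distribution**: `g` is a convex combination of
XOR-fibres of `K`-rectangle functions (the acceptance probability of a randomized protocol /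
algebraic-query machine run on an XOR-masked input, as a function of the unmasked input).
[cite: AaronsonWigderson2008, Thm. 4.11] -/
def FiberAvg (K : ℕ) (g : (Fin m → Bool) → ℝ) : Prop :=
  ∃ (ι : Type) (_ : Fintype ι) (μ : ι → ℝ) (acc : ι → (Fin m → Bool) → (Fin m → Bool) → ℝ),
    (∀ i, 0 ≤ μ i) ∧ ∑ i, μ i = 1 ∧ (∀ i, IsRectSimple K (acc i)) ∧
      ∀ w, g w = ∑ i, μ i * xorFiber (acc i) w

/-- A single fibre is in the class. [folklore] -/
theorem IsRectSimple.fiberAvg {K : ℕ} {acc : (Fin m → Bool) → (Fin m → Bool) → ℝ}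
    (h : IsRectSimple K acc) : FiberAvg K (xorFiber acc) :=
  ⟨Unit, inferInstance, fun _ => 1, fun _ => acc, fun _ => zero_le_one, by simp, fun _ => h,
    fun w => by simp⟩

/-- **Members of the class are `[-1,1]`-valued.** [folklore] -/
theorem FiberAvg.abs_le_one {K : ℕ} {g : (Fin m → Bool) → ℝ} (h : FiberAvg K g) (w : Fin m → Bool) :
    |g w| ≤ 1 := by
  obtain ⟨ι, _, μ, acc, hμ0, hμ1, hrect, hg⟩ := h
  rw [hg w]
  calc |∑ i, μ i * xorFiber (acc i) w| ≤ ∑ i, |μ i * xorFiber (acc i) w| := abs_sum_le_sum_abs _ _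
    _ ≤ ∑ i, μ i := by
        refine sum_le_sum fun i _ => ?_
        rw [abs_mul, abs_of_nonneg (hμ0 i)]
        exact mul_le_of_le_one_right (hμ0 i) (abs_xorFiber_le_one ((hrect i).abs_le_one) w)
    _ = 1 := hμ1

/-- **Fourier growth of the class**: for `k ≥ 1`, `L_{1,k}(g) ≤ (2e(ln K + 3))^k`
(convexity of `L_{1,k}` and `IsRectSimple.l1Level_xorFiber_le`). [cite: ODonnell2014, §9.5 (Level-k Inequalities)] -/
theorem FiberAvg.l1Level_le {K : ℕ} {g : (Fin m → Bool) → ℝ} (h : FiberAvg K g) {k : ℕ}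
    (hk : 1 ≤ k) : l1Level g k ≤ growthConst K ^ k := by
  obtain ⟨ι, _, μ, acc, hμ0, hμ1, hrect, hg⟩ := h
  have hg' : g = fun w => ∑ i ∈ univ, μ i * xorFiber (acc i) w := funext hg
  unfold l1Level
  rw [hg']
  calc ∑ S ∈ univ.powersetCard k, |cubeFourierCoeff (fun w => ∑ i ∈ univ, μ i * xorFiber (acc i) w) S|
      ≤ ∑ S ∈ univ.powersetCard k, ∑ i, μ i * |cubeFourierCoeff (xorFiber (acc i)) S| := by
        refine sum_le_sum fun S _ => ?_
        rw [cubeFourierCoeff_sum_mul]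
        refine (abs_sum_le_sum_abs _ _).trans (sum_le_sum fun i _ => ?_)
        rw [abs_mul, abs_of_nonneg (hμ0 i)]
    _ = ∑ i, μ i * l1Level (xorFiber (acc i)) k := by
        rw [sum_comm]
        exact sum_congr rfl fun i _ => by rw [l1Level, mul_sum]
    _ ≤ ∑ i, μ i * growthConst K ^ k :=
        sum_le_sum fun i _ => mul_le_mul_of_nonneg_left ((hrect i).l1Level_xorFiber_le hk) (hμ0 i)
    _ = growthConst K ^ k := by rw [← sum_mul, hμ1, one_mul]

/-- Restricting the XOR of two points on `J`. [folklore] -/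
theorem piecewise_xorVec (J : Finset (Fin m)) (ξ σ x w : Fin m → Bool) :
    J.piecewise (xorVec ξ σ) (xorVec x w) = xorVec (J.piecewise ξ x) (J.piecewise σ w) := by
  funext i
  by_cases hi : i ∈ J <;> simp [Finset.piecewise, hi]

/-- The swap of the `J`-parts of a pair of points, an involution of `{0,1}^m × {0,1}^m`. [folklore] -/
theorem swapParts_involutive (J : Finset (Fin m)) :
    Function.Involutive fun p : (Fin m → Bool) × (Fin m → Bool) =>
      (J.piecewise p.1 p.2, J.piecewise p.2 p.1) := by
  rintro ⟨ξ, x⟩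
  ext i <;> by_cases hi : i ∈ J <;> simp [Finset.piecewise, hi]

/-- **Averaging a section over the `J`-part of the mask recovers the uniform average**:
`∑_ξ ∑_x F(ξ|_J ∪ x|_{J^c}) = 2^m ∑_z F(z)`. [folklore] -/
theorem sum_sum_piecewise (J : Finset (Fin m)) (F : (Fin m → Bool) → ℝ) :
    ∑ ξ : Fin m → Bool, ∑ x : Fin m → Bool, F (J.piecewise ξ x) = 2 ^ m * ∑ z, F z := by
  rw [← Fintype.sum_prod_type']
  rw [Fintype.sum_equiv (swapParts_involutive J).toPerm
    (fun p : (Fin m → Bool) × (Fin m → Bool) => F (J.piecewise p.1 p.2))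
    (fun q => F q.1) fun p => rfl]
  rw [Fintype.sum_prod_type]
  simp only [sum_const, card_univ, Fintype.card_fun, Fintype.card_bool, Fintype.card_fin,
    nsmul_eq_mul, mul_sum]
  push_cast
  rfl

/-- **The restriction of a fibre is an average of fibres of sections**:
`h(W|_{J←σ}) = 2^{-m} ∑_ξ h_ξ(W)` with `h_ξ` the fibre of `acc(ξ|_J ∪ ·, (ξ ⊕ σ)|_J ∪ ·)`.
[cite: AaronsonWigderson2008, Thm. 4.11] -/
theorem xorFiber_piecewise (acc : (Fin m → Bool) → (Fin m → Bool) → ℝ) (J : Finset (Fin m))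
    (σ w : Fin m → Bool) :
    xorFiber acc (J.piecewise σ w) =
      (∑ ξ : Fin m → Bool, xorFiber (fun x y => acc (J.piecewise ξ x) (J.piecewise (xorVec ξ σ) y)) w) /
        2 ^ m := by
  unfold xorFiber
  simp_rw [piecewise_xorVec]
  rw [← sum_div, sum_sum_piecewise J (fun z => acc z (xorVec z (J.piecewise σ w))),
    mul_div_assoc, mul_div_cancel_left₀ _ (by positivity)]

/-- **The class is closed under restrictions** `W ↦ W|_{J ← σ}` (index the new convex combination
by pairs `(i, ξ)` with weights `μ_i / 2^m`). [cite: AaronsonWigderson2008, Thm. 4.11] -/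
theorem FiberAvg.piecewise {K : ℕ} {g : (Fin m → Bool) → ℝ} (h : FiberAvg K g)
    (J : Finset (Fin m)) (σ : Fin m → Bool) : FiberAvg K fun w => g (J.piecewise σ w) := by
  obtain ⟨ι, hι, μ, acc, hμ0, hμ1, hrect, hg⟩ := h
  refine ⟨ι × (Fin m → Bool), inferInstance, fun p => μ p.1 / 2 ^ m,
    fun p x y => acc p.1 (J.piecewise p.2 x) (J.piecewise (xorVec p.2 σ) y),
    fun p => div_nonneg (hμ0 p.1) (by positivity), ?_, fun p => (hrect p.1).comap _ _, ?_⟩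
  · rw [Fintype.sum_prod_type]
    simp only [sum_const, card_univ, Fintype.card_fun, Fintype.card_bool, Fintype.card_fin,
      nsmul_eq_mul]
    push_cast
    rw [← mul_sum]
    have h2 : (2 : ℝ) ^ m ≠ 0 := by positivity
    calc (2 : ℝ) ^ m * ∑ i, μ i / 2 ^ m = ∑ i, μ i := by rw [← sum_div, mul_div_cancel₀ _ h2]
      _ = 1 := hμ1
  · intro w
    simp only []
    rw [hg, Fintype.sum_prod_type]
    refine sum_congr rfl fun i _ => ?_
    rw [xorFiber_piecewise, div_eq_mul_one_div, sum_mul, mul_sum]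
    exact sum_congr rfl fun ξ _ => by ring

end Literature.Computability.Complexity.LowDegree

end
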